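import Summits.QuantumFields.YangMills.Theorems.BalabanUVNodesN14ClassLawTVDressingTransfer
import Summits.QuantumFields.YangMills.Theorems.BalabanUVNodesN20HellingerRoadOfVarianceAndResponse

/-!
# DAG node N14 (NE1′) → N19′ ∕ N20 — THE HELLINGER ROAD NEEDS ITS VARIANCE LETTER ONLY FOR THE UNDRESSED RUNS AND NO RESPONSE LETTER: in MGF form the dressed
# `∃`-hybrid at a key from (V₀) = dag-n20-w4's variance letter AT ZERO SOURCE + node N14's binder + NE7b's undressed bad weight

Cell `pub-ymgap` (HUMAN RULING D-0062, Track A), WIDTH SEAT `pub-ymgap-dag-n14-w2` (NODE n14 = NE1′), generation 6, FILE 4; `--kind proof --supports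
stmt-QuantumFields-20544 --as helper` (K3⁷; helper, NOT a discharge; count-neutral).  THEOREMS ONLY (0 `def`, 0 `instance`, 0 `sorry`).  Imports this seat's FILE 2b
`…N14ClassLawTVDressingTransfer` (`exists_hybridNE7_dressed_of_undressed`, `classLawTV_dressed_of_undressed`; through it FILE 1 ∕ 2a, NE1′'s `DressedMGFForm`, dag-n20-w4's
p609004) and dag-n20-w4 g2's `…N20HellingerRoadOfVarianceAndResponse` (`abs_classLaw_sub_classLaw_le_half_sqrt`: the tilted-variance letter on `[0,1]` ⇒ per-set class-law TV
`≤ √V∕2`) ONLY — CITED BY NAME; edits nothing.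

WHY.  dag-n20-w4's kernel form of idea-3's `hellinger-free-energy-road` (`exists_hybridNE7_of_variance_and_response`) asks (V) — the tilted variance of the two-run
log-increment bounded by `V_K` UNIFORMLY IN THE SOURCE `|t| ≤ l₀` — and (R) — a response letter for the run-A class mean of the log-increment.  In the MGF form the consumer
reads, this seat's FILE 1 replaced the Target ∕ (R) side by node N14's binder, and FILE 2b moved the class-law TV letter to zero source.  Composing with dag-n20-w4's ONE-`(K,t)`
lemma `abs_classLaw_sub_classLaw_le_half_sqrt` AT `t = 0` gives the present file's single theorem (★★★ `exists_hybridNE7_dressed_of_undressedVariance`): the dressed `∃`-hybrid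
at every `|t| ≤ l₀` from (V₀) = the variance letter for the UNDRESSED class weights `A K 0`, `Bf K 0` only (`Σ_K √V₀_K < ∞`), N14's `TiltedMeanMatching η` (`Σ η < ∞`), NE7b's
undressed bad weight `W₀` (`Σ W₀ < ∞`) and a smallness of the dressed radius `2e^{2l₀B}(√V₀_K∕2 + W₀_K) + 2(e^{l₀η_K} − 1) < 1` — NO response letter, NO source-uniformity in the
variance letter.  (The per-set TV radius at zero source, `classLawTV_undressed_of_variance`, is recorded on the way; §2 inhabits every binder of ★★★ on the one-class
Dirac toy — referee check A6, the hypothesis set is jointly satisfiable and the theorem fires.)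

HONEST FRAMING.  By-name composition on hypothesis SHAPES ([folklore]); (V₀), `η`, `W₀` are HYPOTHESES produced by nobody (no live Stage-13 tuple exhibited, K0⁷ OPEN); proves NO
estimate of the programme; nothing of Bałaban's asserted or instantiated; NE1′ ∕ NE7 ∕ NE7b NOT PRINTED as two-run statements for d = 4, NOT proved; N14 ∕ N19 ∕ N20 NOT
discharged; K3⁷ OPEN, skeleton v5 untouched (the typing of `(∅, 0, shA, shB)` into a pinned reading is the road's K3 ∕ v6, not done here); counts UNMOVED.  One finite 𝕋⁴
programme at fixed ε; R4 closes only the CONDITIONAL finite-𝕋⁴ rung `BalabanLadder.UV` — NOT ℝ⁴, NOT OS, NOT the Yang–Mills mass gap (Clay), which is NOT proved by any of this.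
-/

noncomputable section

open MeasureTheory ProbabilityTheory Finset

namespace YMDAG.N14.HellingerRoadUndressedVariance

open Literature.MathematicalPhysics.QuantumFieldTheory.Balaban1983to89
open Literature.MathematicalPhysics.QuantumFieldTheory.Balaban1983to89.T4MatchingAssembly (HybridNE7)
open Summit.QuantumFields.BalabanUV.T4Continuum.NE1p.DressedMGFForm
open Summit.QuantumFields.YangMills.BalabanUVNodes.N20HellingerRoadOfVarianceAndResponse (abs_classLaw_sub_classLaw_le_half_sqrt)
open YMDAG.N14.ClassLawTVDressingTransfer (exists_hybridNE7_dressed_of_undressed classLawTV_dressed_of_undressed)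

variable {ι : Type*} [DecidableEq ι] {Ω Ω' : ℕ → Type*} [∀ K, MeasurableSpace (Ω K)] [∀ K, MeasurableSpace (Ω' K)]
  {l₀ vol B : ℝ} {T : ℕ → Finset ι} {Bad : ℕ → ℝ → Finset ι}
  {F : ∀ K, Ω K → ℝ} {ν : ∀ K, ι → Measure (Ω K)} {F' : ∀ K, Ω' K → ℝ} {ν' : ∀ K, ι → Measure (Ω' K)}
  {A Bf : ℕ → ℝ → ι → ℝ} {η W₀ V₀ : ℕ → ℝ} {Z : ℕ → ℝ → ℝ}

/-- **(V₀) ⇒ THE UNDRESSED CLASS-LAW TV LETTER** (dag-n20-w4's `abs_classLaw_sub_classLaw_le_half_sqrt` at zero source, BY NAME): the tilted variance of the UNDRESSED two-run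
log-increment `log Bf K 0 − log A K 0` bounded by `V₀ K` on `s ∈ [0,1]` gives dag-n20-w4's per-set letter for the undressed class laws with radius `√V₀_K ∕ 2`. [folklore] -/
theorem classLawTV_undressed_of_variance (hT : ∀ K, (T K).Nonempty) (hA0 : ∀ K, ∀ τ ∈ T K, 0 < A K 0 τ) (hB0 : ∀ K, ∀ τ ∈ T K, 0 < Bf K 0 τ)
    (hV0 : ∀ (K : ℕ), ∀ s ∈ Set.Icc (0:ℝ) 1,
      (∑ τ ∈ T K, A K 0 τ * Real.exp (s * (Real.log (Bf K 0 τ) - Real.log (A K 0 τ))) * (Real.log (Bf K 0 τ) - Real.log (A K 0 τ)) ^ 2)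
          / (∑ τ ∈ T K, A K 0 τ * Real.exp (s * (Real.log (Bf K 0 τ) - Real.log (A K 0 τ))))
        - ((∑ τ ∈ T K, A K 0 τ * Real.exp (s * (Real.log (Bf K 0 τ) - Real.log (A K 0 τ))) * (Real.log (Bf K 0 τ) - Real.log (A K 0 τ)))
          / (∑ τ ∈ T K, A K 0 τ * Real.exp (s * (Real.log (Bf K 0 τ) - Real.log (A K 0 τ))))) ^ 2 ≤ V₀ K)
    (K : ℕ) {S : Finset ι} (hS : S ⊆ T K) :
    |(∑ τ ∈ S, A K 0 τ) / (∑ τ ∈ T K, A K 0 τ) - (∑ τ ∈ S, Bf K 0 τ) / (∑ τ ∈ T K, Bf K 0 τ)| ≤ Real.sqrt (V₀ K) / 2 :=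
  abs_classLaw_sub_classLaw_le_half_sqrt (hT K) (hA0 K) (hB0 K) (hV0 K) hS

/-- ★★★ **THE HELLINGER ROAD, UNDRESSED EDITION: THE DRESSED `∃`-HYBRID FROM (V₀) + N14's BINDER + NE7b's UNDRESSED BAD WEIGHT.**  Two MGF-form runs on one class family with
NONZERO class pieces; (V₀) dag-n20-w4's tilted-variance letter for the UNDRESSED class weights (`s ∈ [0,1]`, `Σ_K √V₀_K < ∞`); N14's `TiltedMeanMatching η` (`0 ≤ η`, `Σ η < ∞`);
the undressed bad weight `Σ_{Bad K t} A K 0 ≤ W₀ K·Σ_{T K} A K 0` (`Σ W₀ < ∞`); the smallness of the dressed radius; the dictionary for the DRESSED partition functions.  THEN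
`∃ shA shB, HybridNE7 l₀ vol T A Bf ∅ 0 shA shB ρ δ` for the DRESSED runs on the whole source window — FILE 2b's `exists_hybridNE7_dressed_of_undressed` at `ρ₀ := √V₀∕2`.
NO response letter (R); NO variance letter at `t ≠ 0`. [folklore] -/
theorem exists_hybridNE7_dressed_of_undressedVariance (hl₀ : 0 ≤ l₀) (hvol : 0 < vol) (hA : MGFForm B T F ν A) (hB : MGFForm B T F' ν' Bf)
    (hη : TiltedMeanMatching l₀ T Bad F ν F' ν' η) (hη0 : ∀ K, 0 ≤ η K) (hηs : Summable η)
    (hBadT : ∀ (K : ℕ) (t : ℝ), |t| ≤ l₀ → Bad K t ⊆ T K)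
    (hW0 : ∀ (K : ℕ) (t : ℝ), |t| ≤ l₀ → ∑ τ ∈ Bad K t, A K 0 τ ≤ W₀ K * ∑ τ ∈ T K, A K 0 τ) (hW0s : Summable W₀)
    (hT : ∀ K, (T K).Nonempty) (hA0 : ∀ K, ∀ τ ∈ T K, 0 < A K 0 τ) (hB0 : ∀ K, ∀ τ ∈ T K, 0 < Bf K 0 τ)
    (hV0 : ∀ (K : ℕ), ∀ s ∈ Set.Icc (0:ℝ) 1,
      (∑ τ ∈ T K, A K 0 τ * Real.exp (s * (Real.log (Bf K 0 τ) - Real.log (A K 0 τ))) * (Real.log (Bf K 0 τ) - Real.log (A K 0 τ)) ^ 2)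
          / (∑ τ ∈ T K, A K 0 τ * Real.exp (s * (Real.log (Bf K 0 τ) - Real.log (A K 0 τ))))
        - ((∑ τ ∈ T K, A K 0 τ * Real.exp (s * (Real.log (Bf K 0 τ) - Real.log (A K 0 τ))) * (Real.log (Bf K 0 τ) - Real.log (A K 0 τ)))
          / (∑ τ ∈ T K, A K 0 τ * Real.exp (s * (Real.log (Bf K 0 τ) - Real.log (A K 0 τ))))) ^ 2 ≤ V₀ K)
    (hVs : Summable fun K => Real.sqrt (V₀ K))
    (hsmall : ∀ K, 2 * Real.exp (2 * l₀ * B) * (Real.sqrt (V₀ K) / 2 + W₀ K) + 2 * (Real.exp (l₀ * η K) - 1) < 1)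
    (hZA' : ∀ (K : ℕ) (t : ℝ), |t| ≤ l₀ → Z K t = ∑ τ ∈ T K, A K t τ)
    (hZB' : ∀ (K : ℕ) (t : ℝ), |t| ≤ l₀ → Z (K + 1) t = ∑ τ ∈ T K, Bf K t τ) :
    ∃ shA shB : ℕ → ℝ → ι → ℝ,
      HybridNE7 l₀ vol T A Bf (fun _ _ => ∅) (fun _ => 0) shA shB
        (fun K => 2 * Real.exp (2 * l₀ * B) * (Real.sqrt (V₀ K) / 2 + W₀ K) + 2 * (Real.exp (l₀ * η K) - 1))
        (fun K => l₀ * (η K + 2 * B * (Real.exp (2 * l₀ * B) * W₀ K)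
          + 2 * B * (2 * Real.exp (2 * l₀ * B) * (Real.sqrt (V₀ K) / 2 + W₀ K) + 2 * (Real.exp (l₀ * η K) - 1))) / vol) :=
  exists_hybridNE7_dressed_of_undressed hl₀ hvol hA hB hη hη0 hηs hBadT hW0 hW0s
    (fun K _ hS => classLawTV_undressed_of_variance hT hA0 hB0 hV0 K hS) (hVs.div_const 2)
    hsmall (fun K => Finset.sum_pos (hA0 K) (hT K)) (fun K => Finset.sum_pos (hB0 K) (hT K)) hZA' hZB'

/-! ## §2 Sanity (A6): the hypothesis set of ★★★ is jointly inhabited — the one-class Dirac toy -/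

/-- The one-class toy family: class set `{()}`, both runs the Dirac mass on `Unit` with the zero observable, so every dressed class total is `1`. [folklore] -/
theorem mgfForm_toy : MGFForm (ι := Unit) (Ω := fun _ => Unit) 0 (fun _ => Finset.univ) (fun _ _ => (0 : ℝ))
    (fun _ _ => Measure.dirac ()) (fun _ _ _ => (1 : ℝ)) where
  nonneg := le_rfl
  meas := fun _ => measurable_const
  bound := fun _ _ => by simp
  finite := fun _ _ _ => by infer_instance
  repr := fun K t τ _ => by simp [mgf]

/-- ★ **NON-VACUITY of `exists_hybridNE7_dressed_of_undressedVariance`**: on the one-class Dirac toy (both runs equal, zero observable, `l₀ = vol = 1`, `Bad = ∅`, `η = W₀ = V₀ = 0`)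
every hypothesis holds and the theorem FIRES, producing a hybrid-NE7 datum.  (Referee check A6: the binders are jointly satisfiable; nothing of Bałaban's.) [folklore] -/
theorem toy_inhabited :
    ∃ (ρ δ : ℕ → ℝ) (shA shB : ℕ → ℝ → Unit → ℝ),
      HybridNE7 (1 : ℝ) 1 (fun _ => (Finset.univ : Finset Unit)) (fun _ _ _ => (1 : ℝ)) (fun _ _ _ => (1 : ℝ)) (fun _ _ => ∅) (fun _ => 0)
        shA shB ρ δ := by
  have hTM : TiltedMeanMatching (Ω := fun _ => Unit) (Ω' := fun _ => Unit) (1 : ℝ) (fun _ => (Finset.univ : Finset Unit)) (fun _ _ => ∅)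
      (fun _ _ => (0 : ℝ)) (fun _ _ => Measure.dirac ()) (fun _ _ => (0 : ℝ)) (fun _ _ => Measure.dirac ()) (fun _ => 0) :=
    fun K t _ τ _ s _ => by simp
  obtain ⟨shA, shB, h⟩ := exists_hybridNE7_dressed_of_undressedVariance (Bad := fun _ _ => ∅) (W₀ := fun _ => 0) (V₀ := fun _ => 0)
    (Z := fun _ _ => (1 : ℝ)) zero_le_one one_pos mgfForm_toy mgfForm_toy hTM (fun _ => le_rfl) summable_zero
    (fun _ _ _ => Finset.empty_subset _) (fun K t _ => by simp) summable_zero (fun _ => Finset.univ_nonempty)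
    (fun _ _ _ => one_pos) (fun _ _ _ => one_pos) (fun K s _ => by simp) (by simp [summable_zero])
    (fun K => by simp) (fun K t _ => by simp) (fun K t _ => by simp)
  exact ⟨_, _, shA, shB, h⟩

end YMDAG.N14.HellingerRoadUndressedVariance

end
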